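import Summits.QuantumFields.BalabanUV.Beta.ChartConjugationRelative

/-!
# The relative-inverse SANDWICH of a commutator contact: `A ∘ (conjV 𝕄 X) ∘ A = −conjV A X`

One identity of tame kernel algebra over the RELATIVE-inverse predicate `ChartConjugationRelative.RelInv A 𝕄 E` (rules
`E∘A = A`, `A∘E = A`, `(A∘𝕄)∘E = E`, `(E∘𝕄)∘A = E`): for a localised contact `X` commuting with the coordinate projector `E`,
`(A ∘ conjV 𝕄 X) ∘ A = −conjV A X`, i.e. `A(𝕄X − X𝕄)A = XA − AX`.  It is the two sandwiched rules `rule_left_rel` ∕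
`rule_right_rel` of that file subtracted.  With a two-sided inverse (`E := idK`) this is the familiar `A[𝕄, X]A = [X, A]`.

WHY IT IS FILED (β sub-cell, row D1): (i) it is the algebraic heart of the RE-TYPED hR leaf (L3) at level 1 (row-owner decision (L3-D),
GAP C-an2-75): the contact of the value-function third jet `e3OfK N K S` inherited from a contact `conjV 𝕄 X` of the stencil family is
the `mm`-read of `K ∘ conjV 𝕄 (…) ∘ K`; for the co-dressed resolvent `K := G_0 = coDressKBmAt ρ_c Lc KInv`, which is only a RELATIVE
inverse of the rooted bordered Hessian `𝕄 = bhKAt` (`relInv_coDressKBmAt_KInv_bhKAt`), this lemma replaces an3's straight evaluation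
(`comp_KInv_bhK`) and yields `−mmRead N (conjV G_0 (…))` — a diagonal contact, as the exact toy of an3-g29 predicts for the dressed
reading; (ii) it is also the shape of the kernel Ward socket (W1) `A∘(divV V y)∘A = A∘X − X∘A` given the first-order law
`divV V y = conjV 𝕄 X′` (take `X := −X′`).  [folklore]; axioms standard; no existing file touched.
-/

open Finset
open scoped BigOperators
open Literature.MathematicalPhysics.QuantumFieldTheory.Balaban1983to89
open Literature.MathematicalPhysics.QuantumFieldTheory.Balaban1983to89.Beta
open ExpKernelCalculus (MKer Decays BiLoc comp)
open Summit.QuantumFields.BalabanUV.Beta.TameKernelCalculus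
open Summit.QuantumFields.BalabanUV.Beta.ChartConjugation

namespace Summit.QuantumFields.BalabanUV.Beta.ChartConjugationRelative

noncomputable section

variable {D : ℕ} {F : Type*} [Fintype F] {A M E : MKer D F}

/-- [folklore] `A∘(𝕄∘X)∘A = X∘A` — `rule_left_rel` with the inner product re-associated. -/
theorem sandwich_comp_M_X (hA : Spr A) (hM : Spr M) (hE : Spr E) (hR : RelInv A M E) {X : MKer D F} (hX : Loc X)
    (hEX : comp E X = comp X E) : comp (comp A (comp M X)) A = comp X A := by
  rw [comp_assoc_tame hA.tame hM.tame hX.tame,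
    ← comp_assoc_tame (spr_comp hA hM).tame hX.tame hA.tame]
  exact rule_left_rel hA hM hE hR hX hEX

/-- [folklore] `A∘(X∘𝕄)∘A = A∘X` — `rule_right_rel` with the inner product re-associated. -/
theorem sandwich_comp_X_M (hA : Spr A) (hM : Spr M) (hE : Spr E) (hR : RelInv A M E) {X : MKer D F} (hX : Loc X)
    (hEX : comp E X = comp X E) : comp (comp A (comp X M)) A = comp A X := by
  rw [comp_assoc_tame hA.tame hX.tame hM.tame,
    ← comp_assoc_tame (hA.comp_loc hX).tame hM.tame hA.tame]
  exact rule_right_rel hA hM hE hR hX hEX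

/-- [folklore] **THE RELATIVE-INVERSE SANDWICH OF A COMMUTATOR CONTACT**: `(A ∘ conjV 𝕄 X) ∘ A = −conjV A X` for `RelInv A 𝕄 E`,
`X` localised and commuting with `E` (all of `A`, `𝕄`, `E` spread).  With `E := idK`: `A[𝕄, X]A = [X, A]`. -/
theorem sandwich_conjV_rel (hA : Spr A) (hM : Spr M) (hE : Spr E) (hR : RelInv A M E) {X : MKer D F} (hX : Loc X)
    (hEX : comp E X = comp X E) : comp (comp A (conjV M X)) A = -conjV A X := by
  have hMX : Loc (comp M X) := hM.comp_loc hX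
  have hXM : Loc (comp X M) := hX.comp_spr hM
  unfold ChartConjugation.conjV
  rw [comp_sub_right_tame hA.tame hMX.tame hXM.tame,
    comp_sub_left_tame (hA.comp_loc hMX).tame (hA.comp_loc hXM).tame hA.tame,
    sandwich_comp_M_X hA hM hE hR hX hEX, sandwich_comp_X_M hA hM hE hR hX hEX, neg_sub]

end

end Summit.QuantumFields.BalabanUV.Beta.ChartConjugationRelative
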